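import Summits.CriticalPhenomena.PercolationContinuityZ3.Theorems.TallClusterMassBound.Negative.FalseWithoutCriticality
import Summits.CriticalPhenomena.PercolationContinuityZ3.Theorems.PercShatteringRaceFreeSusceptibilityPowerSavingHyperscaling
import Literature.Probability.Percolation.UniversalTightness
import Literature.Probability.Percolation.HalfSpaceFloorDilution
import Literature.Probability.Percolation.MeanFieldBetaFromGamma
import Literature.Probability.Percolation.LongRangeVolumeTailBootstrap
import Literature.Probability.LatticeModels.ProdBernoulliCoupling
import Mathlib.Analysis.SpecialFunctions.Pow.Real

/-!
# `TallClusterMassBound` (stmt-CriticalPhenomena-0912), line `SketchIdeator4` — stub `stub_firstMomentTransfer`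

ARROW 2 of the line (an ENGINE for the open residual C⁺): a bulk critical volume tail
`P_{p_c}(|C(0)| ≥ n) ≤ C n^{-θ}` (`0 < θ ≤ 1`, integers `n ≥ 1`) gives
`typicalMax PcH (halfBox r) ≤ C' r^{3/(1+θ)}` for all `r ≥ 1`, where
`PcH = floorDilutedPercolation 3 p_c 1 = prodBernoulli (floorDilutedParam 3 p_c 1)` is bond
percolation on the INDUCED half-space and `halfBox r = B_r ∩ ℍ`.

Proof (first moment for the maximum, Hutchcroft 2021, proof of Thm 2.1, p. 14).
* The root-uniform in-`Λ` tail under `PcH`: for `v ∈ Λ = halfBox r`, `n ≥ 1`,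
  `PcH(n ≤ |K_v ∩ Λ|) ≤ PcH(|K_v| ≥ n) ≤ P_{p_c}(|K_v| ≥ n) = P_{p_c}(|K_0| ≥ n) ≤ max(C,1) n^{-θ}`:
  `{n ≤ |K_v ∩ Λ|} ⊆ clusterSizeGe v n` (`StubHyperscaling.setOf_le_clusterCapIn_subset_clusterSizeGe`),
  the monotone coupling `PcH ≤ P_{p_c}` on increasing events (the weights `floorDilutedParam 3 p_c 1`
  are dominated by `p_c 𝟙_{E(ℤ³)}`, `prodBernoulli_real_mono_of_isUpperSet`,
  `StubHyperscaling.prodBernoulli_edgeIndicator`), and translation invariance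
  (`StubHyperscaling.real_clusterSizeGe_shift`).
* The landed first-moment lever `stub_typicalMaxBound` (counting + Markov + minimality of the
  typical value): `(M - 1)^{1+θ} ≤ e · max(C,1) · |Λ|`.
* Bookkeeping: `|Λ| ≤ |B_r| = (2r+1)³ ≤ 27 r³`, so `M ≤ 1 + (27 e max(C,1))^{1/(1+θ)} r^{3/(1+θ)}
  ≤ C' r^{3/(1+θ)}` with `C' = (27 e max(C,1))^{1/(1+θ)} + 1` (`r ≥ 1`).
No definitions.
-/

noncomputable section

open MeasureTheory Finset Filter
open Literature.Probability.Percolation Literature.Probability.LatticeModels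
open Summit.CriticalPhenomena.PercolationContinuityZ3.Theorems.TallClusterMassBound.Negative

namespace Summit.CriticalPhenomena.PercolationContinuityZ3.Theorems.TallClusterMassBound.TightnessLine

/-- **Monotone coupling `PcH ≤ P_p` on increasing events.** The weights of the induced half-space
percolation `floorDilutedParam 3 p 1` (`p` on the edges of `ℤ³` inside `ℍ`, `0` elsewhere) are
dominated by those of `P_p` (`p` on every edge of `ℤ³`, `0` on non-edges), so for every increasing
measurable event `A`, `PcH(A) ≤ P_p(A)` (Grimmett 1999, Thm. (2.1)). [folklore] -/
theorem real_floorDilutedPercolation_one_le (p : unitInterval) {A : Set (BondConfig V3)}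
    (hA : IsUpperSet A) (hAm : MeasurableSet A) :
    (floorDilutedPercolation 3 p 1).real A ≤ (Pp p).real A := by
  rw [Pp, ← StubHyperscaling.prodBernoulli_edgeIndicator, floorDilutedPercolation]
  refine prodBernoulli_real_mono_of_isUpperSet (fun e => ?_) hA hAm
  dsimp only
  split_ifs with he
  · exact floorDilutedParam_le p 1 e
  · exact (floorDilutedParam_of_not_mem_halfSpaceEdgeSet p 1 fun h => he h.1).le

/-- **Root-uniform half-space tail from the bulk tail at the origin.** For every vertex `v`, finite
`Λ` and `n`: `PcH(n ≤ |K_v ∩ Λ|) ≤ P_p(|K_0| ≥ n)` — the trace on `Λ` is a finite part of the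
cluster, `PcH ≤ P_p` on the increasing event `{|K_v| ≥ n}`, and translation invariance of `P_p`.
[folklore] -/
theorem real_clusterCapIn_ge_floorDiluted_le (p : unitInterval) (Λ : Finset V3) (v : V3) (n : ℕ) :
    (floorDilutedPercolation 3 p 1).real {ω | n ≤ clusterCapIn Λ ω v} ≤
      (Pp p).real (clusterSizeGe (0 : V3) n) :=
  calc (floorDilutedPercolation 3 p 1).real {ω | n ≤ clusterCapIn Λ ω v}
      ≤ (floorDilutedPercolation 3 p 1).real (clusterSizeGe v n) :=
        measureReal_mono (StubHyperscaling.setOf_le_clusterCapIn_subset_clusterSizeGe Λ v n)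
    _ ≤ (Pp p).real (clusterSizeGe v n) :=
        real_floorDilutedPercolation_one_le p (isUpperSet_clusterSizeGe v n)
          (measurableSet_clusterSizeGe v n)
    _ = (Pp p).real (clusterSizeGe (0 : V3) n) := StubHyperscaling.real_clusterSizeGe_shift p v n

/-- `halfBox r` is nonempty (it contains the origin `up 0`). [folklore] -/
theorem halfBox_nonempty_fm (r : ℕ) : (halfBox r).Nonempty :=
  ⟨up 0, cube_subset_halfBox r (up_mem_cube (Nat.zero_le r))⟩

/-- `|halfBox r| ≤ |B_r| = (2r+1)³ ≤ 27 r³` for `r ≥ 1`. [folklore] -/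
theorem card_halfBox_le {r : ℕ} (hr : 1 ≤ r) : ((halfBox r).card : ℝ) ≤ 27 * (r : ℝ) ^ 3 := by
  have h1 : (halfBox r).card ≤ (box 3 r).card := card_le_card (halfBox_subset_box r)
  rw [card_box] at h1
  have hr' : (1 : ℝ) ≤ r := by exact_mod_cast hr
  have h2 : ((halfBox r).card : ℝ) ≤ (2 * (r : ℝ) + 1) ^ 3 := by exact_mod_cast h1
  have h3 : (2 * (r : ℝ) + 1) ^ 3 ≤ (3 * (r : ℝ)) ^ 3 :=
    pow_le_pow_left₀ (by positivity) (by linarith) 3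
  linarith [show (3 * (r : ℝ)) ^ 3 = 27 * (r : ℝ) ^ 3 by ring]

/-- **First moment for the typical maximum of the induced half-space percolation** (the lever
`stub_typicalMaxBound` fed with the root-uniform tail): a bulk tail
`P_{p}(|C(0)| ≥ n) ≤ C n^{-θ}` (`θ ≥ 0`) gives `(M - 1)^{1+θ} ≤ 27 e max(C,1) r³` for
`M = typicalMax PcH (halfBox r)`, `r ≥ 1`. [folklore] -/
theorem typicalMax_sub_one_rpow_le (p : unitInterval) {θ C : ℝ} (hθ : 0 ≤ θ)
    (hV : ∀ n : ℕ, 1 ≤ n → (Pp p).real (clusterSizeGe (0 : V3) n) ≤ C * (n : ℝ) ^ (-θ))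
    {r : ℕ} (hr : 1 ≤ r) :
    ((typicalMax (floorDilutedPercolation 3 p 1) (halfBox r) : ℝ) - 1) ^ (1 + θ) ≤
      27 * Real.exp 1 * max C 1 * (r : ℝ) ^ 3 := by
  have htail : ∀ v ∈ halfBox r, ∀ n : ℕ, 1 ≤ n →
      (prodBernoulli (floorDilutedParam 3 p 1)).real {ω | n ≤ clusterCapIn (halfBox r) ω v} ≤
        max C 1 * (n : ℝ) ^ (-θ) := by
    intro v _ n hn
    calc (prodBernoulli (floorDilutedParam 3 p 1)).real {ω | n ≤ clusterCapIn (halfBox r) ω v}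
        ≤ (Pp p).real (clusterSizeGe (0 : V3) n) :=
          real_clusterCapIn_ge_floorDiluted_le p (halfBox r) v n
      _ ≤ C * (n : ℝ) ^ (-θ) := hV n hn
      _ ≤ max C 1 * (n : ℝ) ^ (-θ) :=
          mul_le_mul_of_nonneg_right (le_max_left _ _) (Real.rpow_nonneg (Nat.cast_nonneg _) _)
  have hM := stub_typicalMaxBound V3 (floorDilutedParam 3 p 1) (halfBox r) θ (max C 1) hθ
    (le_max_right _ _) (halfBox_nonempty_fm r) htail
  have hPcH : floorDilutedPercolation 3 p 1 = prodBernoulli (floorDilutedParam 3 p 1) := rfl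
  rw [hPcH]
  refine hM.trans ?_
  have hA : 0 ≤ Real.exp 1 * max C 1 :=
    mul_nonneg (Real.exp_pos 1).le (le_trans zero_le_one (le_max_right _ _))
  have := mul_le_mul_of_nonneg_left (card_halfBox_le hr) hA
  linarith

/-- **STUB 3 (ARROW 2, ENGINE) — first moment for the maximum.** A bulk critical volume tail
`P_{p_c}(|C(0)| ≥ n) ≤ C n^{-θ}` (`0 < θ ≤ 1`) gives `typicalMax PcH (halfBox r) ≤ C' r^{3/(1+θ)}`
for all `r ≥ 1`, `PcH = floorDilutedPercolation 3 p_c 1`: on `{|K_max(Λ)| ≥ n}` at least `n` vertices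
`v ∈ Λ` have `|K_v ∩ Λ| ≥ n` (Markov on the count), `{|K_v ∩ Λ| ≥ n} ⊆ clusterSizeGe v n`,
`PcH ≤ P_{p_c}` on increasing events, translation invariance, `|Λ_r| ≤ 27 r³`, and the minimality of
the typical value; `C' = (27 e max(C,1))^{1/(1+θ)} + 1`. [folklore] -/
theorem stub_firstMomentTransfer :
    ∀ (θ C : ℝ), 0 < θ → θ ≤ 1 →
      (∀ n : ℕ, 1 ≤ n → (Pp (criticalProbI 3)).real (clusterSizeGe (0 : V3) n) ≤ C * (n : ℝ) ^ (-θ)) →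
      ∃ C' : ℝ, ∀ r : ℕ, 1 ≤ r →
        (typicalMax (floorDilutedPercolation 3 (criticalProbI 3) 1) (halfBox r) : ℝ) ≤
          C' * (r : ℝ) ^ (3 / (1 + θ)) := by
  intro θ C hθ _hθ1 hV
  set B : ℝ := 27 * Real.exp 1 * max C 1 with hB
  have hB0 : 0 < B := by
    rw [hB]
    exact mul_pos (mul_pos (by norm_num) (Real.exp_pos 1)) (lt_of_lt_of_le zero_lt_one (le_max_right _ _))
  have h1θ : 0 < 1 + θ := by linarith
  refine ⟨B ^ (1 + θ)⁻¹ + 1, fun r hr => ?_⟩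
  have hr' : (1 : ℝ) ≤ r := by exact_mod_cast hr
  have hr0 : (0 : ℝ) ≤ r := by linarith
  set M : ℕ := typicalMax (floorDilutedPercolation 3 (criticalProbI 3) 1) (halfBox r) with hMdef
  have hM2 : 2 ≤ M := two_le_typicalMax _ (halfBox_nonempty_fm r)
  have hX0 : (0 : ℝ) ≤ (M : ℝ) - 1 := by
    have : (2 : ℝ) ≤ M := by exact_mod_cast hM2
    linarith
  -- `(M - 1)^{1+θ} ≤ B r³`
  have hpow : ((M : ℝ) - 1) ^ (1 + θ) ≤ B * (r : ℝ) ^ 3 := by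
    have := typicalMax_sub_one_rpow_le (criticalProbI 3) hθ.le hV hr
    rw [hB]; linarith
  -- take `(1+θ)`-th roots
  have hroot : (M : ℝ) - 1 ≤ B ^ (1 + θ)⁻¹ * (r : ℝ) ^ (3 / (1 + θ)) := by
    have h1 : (M : ℝ) - 1 = (((M : ℝ) - 1) ^ (1 + θ)) ^ (1 + θ)⁻¹ :=
      (Real.rpow_rpow_inv hX0 h1θ.ne').symm
    have h2 : (((M : ℝ) - 1) ^ (1 + θ)) ^ (1 + θ)⁻¹ ≤ (B * (r : ℝ) ^ 3) ^ (1 + θ)⁻¹ :=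
      Real.rpow_le_rpow (Real.rpow_nonneg hX0 _) hpow (inv_nonneg.2 h1θ.le)
    have h3 : (B * (r : ℝ) ^ 3) ^ (1 + θ)⁻¹ = B ^ (1 + θ)⁻¹ * (r : ℝ) ^ (3 / (1 + θ)) := by
      rw [Real.mul_rpow hB0.le (pow_nonneg hr0 3), div_eq_mul_inv, Real.rpow_mul hr0,
        Real.rpow_ofNat]
    calc (M : ℝ) - 1 = (((M : ℝ) - 1) ^ (1 + θ)) ^ (1 + θ)⁻¹ := h1
      _ ≤ (B * (r : ℝ) ^ 3) ^ (1 + θ)⁻¹ := h2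
      _ = B ^ (1 + θ)⁻¹ * (r : ℝ) ^ (3 / (1 + θ)) := h3
  -- `1 ≤ r^{3/(1+θ)}`
  have hrs : (1 : ℝ) ≤ (r : ℝ) ^ (3 / (1 + θ)) :=
    Real.one_le_rpow hr' (div_nonneg (by norm_num) h1θ.le)
  calc (M : ℝ) = ((M : ℝ) - 1) + 1 := by ring
    _ ≤ B ^ (1 + θ)⁻¹ * (r : ℝ) ^ (3 / (1 + θ)) + (r : ℝ) ^ (3 / (1 + θ)) := add_le_add hroot hrs
    _ = (B ^ (1 + θ)⁻¹ + 1) * (r : ℝ) ^ (3 / (1 + θ)) := by ring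

end Summit.CriticalPhenomena.PercolationContinuityZ3.Theorems.TallClusterMassBound.TightnessLine

end
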